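import Summits.KontsevichZagierPeriods.KontsevichZagierPeriods.Theorems.SoloBlindBeta
import Summits.KontsevichZagierPeriods.KontsevichZagierPeriods.Theorems.SoloBlindSubgraph
import Summits.KontsevichZagierPeriods.KontsevichZagierPeriods.Theorems.SoloBlindZetaTwoReps
import HarnessLib

/-!
# Beta regions: the functional equations of `B(a,b)` as equivalences of rational regions

For natural numbers `m, l` and `n = k+1 ≥ 1` the planar region

  `R_{m,l;n} = {(x,y) | 0 < x < 1, 0 ≤ y, yⁿ ≤ xᵐ(1-x)ˡ}`

is `ℚ`-rational in the literal sense of Kontsevich–Zagier (polynomial inequalities over `ℚ`,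
integrand `1`), with a curved algebraic boundary, and ONE Newton–Leibniz move identifies it with
Euler's integral: **`[R_{m,l;n}] = β(m/n + 1, l/n + 1)`** in `Q` (`mkQ_betaRegion`).  The
functional equations of `B`, proved inside the rules in `SoloBlindBeta`, thereby become explicit
Kontsevich–Zagier equivalences between RATIONAL PLANAR REGIONS — exactly the kind of statement the
conjecture predicts from an equality of areas:

* symmetry: **`R_{m,l;n} ≡ R_{l,m;n}`** (`kz_betaRegion_swap`);
* translation: **`(a+b)·R_{m,l+n;n} ≡ b·R_{m,l;n}`**, `a = m/n+1`, `b = l/n+1`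
  (`kz_betaRegion_transl`) — integration by parts as a chain of moves between two curved regions;
* `n = 2`, `m = l = 1`: the half disc `{y² ≤ x(1-x)}` on the diameter `[0,1]` has class
  **`β(3/2,3/2) = ⅛x_π`** (`mkQ_halfDisc`), lies in the cell span, has area `π/8` read off from
  the moves, and satisfies the conjecture against all of `V` (`kz_halfDisc`).

References: Kontsevich–Zagier, *Periods* (2001), §1.1–1.2. -/

noncomputable section

namespace Summit.KontsevichZagierPeriods.KontsevichZagierPeriods.Theorems

open Set MeasureTheory
open Literature.ModelTheory.ExponentialFields (IsSemialgebraic)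
open MvPolynomial (aeval X C)
open Literature.NumberTheory.Transcendental
open Literature.NumberTheory.Transcendental.KZ

namespace SoloBlind

variable (m l k : ℕ)

/-- The Beta parameter `m/n + 1`, `n = k+1`. -/
def betaE : ℚ := (m : ℚ) / (k + 1) + 1

/-- `0 < m/n + 1`. -/
theorem betaE_pos : 0 < betaE m k := by rw [betaE]; positivity

/-- `0 ≤ m/n` in `ℝ`. -/
theorem betaE_sub_one_nonneg : (0:ℝ) ≤ ((betaE m k : ℚ) : ℝ) - 1 := by
  rw [betaE]; push_cast; ring_nf; positivity

/-- `(m/n)·n = m` in `ℝ`. -/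
theorem betaE_sub_one_mul : (((betaE m k : ℚ) : ℝ) - 1) * ((k:ℝ) + 1) = m := by
  rw [betaE]; push_cast; field_simp; ring

/-- `m/n + 1 + 1 = (m+n)/n + 1`: the translated parameter. -/
theorem betaE_add : betaE (l + (k + 1)) k = betaE l k + 1 := by
  simp only [betaE]; push_cast; field_simp

/-- The graph function `g(x) = x^{m/n}(1-x)^{l/n}`, written as the Beta integrand. -/
def betaG (x : ℝ) : ℝ :=
  x ^ (((betaE m k : ℚ) : ℝ) - 1) * (1 - x) ^ (((betaE l k : ℚ) : ℝ) - 1)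

/-- `0 ≤ g(x)` on `(0,1)`. -/
theorem betaG_nonneg {x : ℝ} (hx : x ∈ Ioo (0:ℝ) 1) : 0 ≤ betaG m l k x :=
  mul_nonneg (Real.rpow_nonneg hx.1.le _) (Real.rpow_nonneg (sub_pos.mpr hx.2).le _)

/-- `g(x)ⁿ = xᵐ(1-x)ˡ` on `(0,1)`. -/
theorem betaG_pow {x : ℝ} (hx : x ∈ Ioo (0:ℝ) 1) :
    betaG m l k x ^ (k + 1) = x ^ m * (1 - x) ^ l := by
  have h1 : (0:ℝ) ≤ 1 - x := (sub_pos.mpr hx.2).le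
  rw [betaG, mul_pow, ← Real.rpow_natCast, ← Real.rpow_mul hx.1.le, ← Real.rpow_natCast,
    ← Real.rpow_mul h1, Nat.cast_succ, betaE_sub_one_mul, betaE_sub_one_mul, Real.rpow_natCast,
    Real.rpow_natCast]

/-! ## The region `R_{m,l;n}` -/

/-- `R_{m,l;n} = {0 < x < 1, 0 ≤ y, yⁿ ≤ xᵐ(1-x)ˡ}`. -/
def kzBetaR : Set (Fin 2 → ℝ) :=
  {z | (0 < z 0 ∧ z 0 < 1) ∧ 0 ≤ z 1 ∧ z 1 ^ (k + 1) ≤ z 0 ^ m * (1 - z 0) ^ l}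

/-- `R_{m,l;n}` is `ℚ`-semialgebraic. -/
theorem isSemialgebraic_kzBetaR : IsSemialgebraic ℚ (kzBetaR m l k) := by
  convert isSemialgebraic_subgraph (X 1 ^ (k + 1)) (X 0 ^ m * (1 - X 0) ^ l) using 1
  ext z
  simp [kzBetaR]

/-- `R_{m,l;n}` is the region under the graph of `g`. -/
theorem kzBetaR_eq : kzBetaR m l k = {z | (0 < z 0 ∧ z 0 < 1) ∧ 0 ≤ z 1 ∧
    z 1 ≤ (z 0) ^ (((betaE m k : ℚ) : ℝ) - 1) * (1 - z 0) ^ (((betaE l k : ℚ) : ℝ) - 1)} := by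
  ext z
  simp only [kzBetaR, mem_setOf_eq]
  refine and_congr_right fun hx => and_congr_right fun hy => ?_
  show _ ↔ z 1 ≤ betaG m l k (z 0)
  rw [← pow_le_pow_iff_left₀ hy (betaG_nonneg m l k hx) k.succ_ne_zero, betaG_pow m l k hx]

/-- `R_{m,l;n}` lies in the unit square. -/
theorem kzBetaR_subset : kzBetaR m l k ⊆ Icc 0 1 := subset_Icc_of_le_one fun z hz => by
  obtain ⟨hx, hy, h⟩ := hz
  refine ⟨hx, hy, ?_⟩
  have h1 : z 1 ^ (k + 1) ≤ 1 := h.trans (mul_le_one₀ (pow_le_one₀ hx.1.le hx.2.le)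
    (pow_nonneg (sub_pos.mpr hx.2).le _) (pow_le_one₀ (sub_pos.mpr hx.2).le (by linarith [hx.1])))
  exact (pow_le_one_iff_of_nonneg hy k.succ_ne_zero).mp h1

/-- **`R_{m,l;n} = [{0<x<1, 0≤y, yⁿ ≤ xᵐ(1-x)ˡ}, 1]`**, with `ℚ`-rational data. -/
def betaRegion : IntegralRep 2 :=
  ratRep (kzBetaR m l k) (fun _ => 1) 1 1 (isSemialgebraic_kzBetaR m l k) (fun _ _ => by simp)
    (fun _ _ => by simp) (integrableOn_one_of_subset_Icc (kzBetaR_subset m l k))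

/-- `R_{m,l;n}` has KZ's literal rational shape. -/
theorem isRational_betaRegion : (betaRegion m l k).IsRational := isRational_ratRep

/-- **Move (Newton–Leibniz): `R_{m,l;n} ≡ β(m/n+1, l/n+1)`.** -/
theorem betaRegion_sub_betaRep :
    of (betaRegion m l k) - of (betaRep (betaE m k) (betaE l k) (betaE_pos m k) (betaE_pos l k))
      ∈ relations := by
  unfold betaRep
  exact subgraph_sub_lineRep (betaRegion m l k) (fun _ hx => betaG_nonneg m l k hx)
    (kzBetaR_eq m l k) rfl

/-- **`[R_{m,l;n}] = β(m/n+1, l/n+1)`** in `Q`. -/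
theorem mkQ_betaRegion : mkQ (of (betaRegion m l k)) = betaQ (betaE m k) (betaE l k) := by
  rw [betaQ_eq (betaE_pos m k) (betaE_pos l k), mkQ_eq_mkQ_iff]
  exact betaRegion_sub_betaRep m l k

/-- **`area(R_{m,l;n}) = Γ(a)Γ(b)/Γ(a+b)`**, `a = m/n+1`, `b = l/n+1`, read off from the move. -/
theorem betaRegion_value : (betaRegion m l k).value =
    Real.Gamma (betaE m k) * Real.Gamma (betaE l k) / Real.Gamma ((betaE m k : ℚ) + betaE l k) := by
  have h := congrArg evalQ (mkQ_betaRegion m l k)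
  rwa [evalQ_mkQ, eval_of, evalQ_betaQ (betaE_pos m k) (betaE_pos l k)] at h

/-! ## The functional equations as equivalences of regions -/

/-- **Symmetry: `R_{m,l;n} ≡ R_{l,m;n}`** (the reflection `x ↦ 1-x` as a chain of moves). -/
theorem kz_betaRegion_swap : Equivalent (betaRegion m l k) (betaRegion l m k) := by
  rw [Equivalent, ← mkQ_eq_mkQ_iff, mkQ_betaRegion, mkQ_betaRegion,
    betaQ_symm (betaE_pos m k) (betaE_pos l k)]

/-- **Translation: `(a+b)·R_{m,l+n;n} ≡ b·R_{m,l;n}`** — integration by parts, inside the rules,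
between two curved rational regions scaled by rationals. -/
theorem kz_betaRegion_transl :
    Equivalent ((betaRegion m (l + (k + 1)) k).constMul ((betaE m k + betaE l k : ℚ) : ℝ)
        (isAlgebraic_rat ℚ _))
      ((betaRegion m l k).constMul ((betaE l k : ℚ) : ℝ) (isAlgebraic_rat ℚ _)) := by
  rw [Equivalent, ← mkQ_eq_mkQ_iff, mkQ_constMul_ratCast, mkQ_constMul_ratCast, mkQ_betaRegion,
    mkQ_betaRegion, betaE_add]
  exact betaQ_transl (betaE_pos m k) (betaE_pos l k)

/-! ## The half disc `{y² ≤ x(1-x)}` -/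

/-- `1/2 + 1 = 3/2`: the parameter of the half disc. -/
theorem betaE_one_one : betaE 1 1 = 3 / 2 := by rw [betaE]; norm_num

/-- `β(½,3/2) = ½x_π` (translation from `β(½,½) = x_π`). -/
theorem betaQ_half_threeHalves : betaQ (1 / 2) (3 / 2) = (((1:ℚ) / 2 : ℚ) : K₀) • xPi := by
  have h := betaQ_transl (a := 1 / 2) (b := 1 / 2) (by norm_num) (by norm_num)
  rw [show ((1:ℚ) / 2 + 1 / 2 : ℚ) = 1 by norm_num, show ((1:ℚ) / 2 + 1 : ℚ) = 3 / 2 by norm_num,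
    Rat.cast_one, one_smul, betaQ_half_half] at h
  exact h

/-- **`β(3/2,3/2) = ⅛x_π`** in `Q` (two translations and a symmetry, inside the rules). -/
theorem betaQ_threeHalves : betaQ (3 / 2) (3 / 2) = (((1:ℚ) / 8 : ℚ) : K₀) • xPi := by
  have h := betaQ_transl (a := 3 / 2) (b := 1 / 2) (by norm_num) (by norm_num)
  rw [show ((3:ℚ) / 2 + 1 / 2 : ℚ) = 2 by norm_num, show ((1:ℚ) / 2 + 1 : ℚ) = 3 / 2 by norm_num,
    betaQ_symm (a := 3 / 2) (b := 1 / 2) (by norm_num) (by norm_num), betaQ_half_threeHalves,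
    smul_smul, ← Rat.cast_mul,
    show ((1:ℚ) / 2 * (1 / 2) : ℚ) = 1 / 4 by norm_num] at h
  have h2 := congrArg (fun q : Q => (((1:ℚ) / 2 : ℚ) : K₀) • q) h
  simp only [smul_smul, ← Rat.cast_mul] at h2
  rw [show ((1:ℚ) / 2 * 2 : ℚ) = 1 by norm_num, Rat.cast_one, one_smul] at h2
  rw [h2]
  norm_num

/-- **`[half disc] = ⅛x_π`**: the region `{0<x<1, 0≤y, y² ≤ x(1-x)}`. -/
theorem mkQ_halfDisc : mkQ (of (betaRegion 1 1 1)) = (((1:ℚ) / 8 : ℚ) : K₀) • xPi := by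
  rw [mkQ_betaRegion, betaE_one_one, betaQ_threeHalves]

/-- The half disc lies in the cell span `V`. -/
theorem mkQ_halfDisc_mem_cellSpan : mkQ (of (betaRegion 1 1 1)) ∈ cellSpan := by
  rw [mkQ_halfDisc]
  exact Submodule.smul_mem _ _ xPi_mem_cellSpan

/-- `area(half disc of radius ½) = π/8`, from the class. -/
theorem halfDisc_value : (betaRegion 1 1 1).value = Real.pi / 8 := by
  have h := congrArg evalQ mkQ_halfDisc
  rw [evalQ_mkQ, eval_of, evalQ_smul, evalQ_xPi, coe_ratCast_K₀] at h
  rw [h]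
  push_cast
  ring

/-- **The Kontsevich–Zagier conjecture for the half disc** `{y² ≤ x(1-x)}` against every
representation with class in `V` (Baker). -/
theorem kz_halfDisc {d : ℕ} (r' : IntegralRep d) (hr' : mkQ (of r') ∈ cellSpan)
    (hv : (betaRegion 1 1 1).value = r'.value) : Equivalent (betaRegion 1 1 1) r' := by
  rw [Equivalent, ← mkQ_eq_mkQ_iff, ← sub_eq_zero]
  exact eq_zero_of_mem_cellSpan (sub_mem mkQ_halfDisc_mem_cellSpan hr')
    (by rw [map_sub, evalQ_mkQ, evalQ_mkQ, eval_of, eval_of, hv, sub_self])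

end SoloBlind

end Summit.KontsevichZagierPeriods.KontsevichZagierPeriods.Theorems
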